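import Literature.MathematicalPhysics.QuantumFieldTheory.Balaban1983to89.T4TermwiseClosure

/-!
# T⁴ continuum, node U5 (NE7), TERM-WISE member — the E-group's share of hazard H-U5b-1 DISCHARGED by the tower rate

Lineage t4-ne7-p1 (term-wise matching modulo constants), generation 5.  HONEST FRAMING (page 1): pure YM₄ on a FIXED
FINITE torus T⁴, rung (B)+1 of the cell's ladder = the `ε → 0` limit of expectations of gauge-invariant observables;
NOT infinite volume, NOT a mass gap, NOT the Clay problem.  Spine estimate NE7 (node U5: for every `K` a `t`-independent
constant `c_K` with `|log Z^B_{K+1}(t) − log Z^A_K(t) − c_K| ≤ δ_K·|T₁|`, `Σ_K δ_K < ∞`) is NOT PRINTED for Bałaban's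
d = 4 procedure; its d = 2, 3 template is [King1986] (3.10)–(3.13) pp. 656–657 (TEMPLATE ONLY).  Every estimate below is a
HYPOTHESIS BINDER named in the statement; nothing of Bałaban's expansions is asserted; no conditional (BetaPertH, (B),
(B^μ)) is hidden — they sit by name inside the producers of the binders exactly where those modules declare them (node U2's
asymptotic-freedom input behind `hinj`: `T4CouplingMatching.EventualLowerH` / `T4TowerRateDischarge.uRateUpTo_of_spine`).
All declarations are [folklore] bookkeeping (finite sums, the triangle inequality, composition of tree theorems).
NO definitions, no cite tags.

## Why this leaf (cross-read advisory A1 on generation 4, C-pv01-76)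
Generation 4's capstone `T4TermwiseClosure.hasContinuumLimit_of_nodes` exposes the tower's rate constant only as
`∃ Cr ≥ 0`, while the premise it then asks for — hazard H-U5b-1, binder (D): «the chosen term constant
`Σ_j sliceCentre κ₁ κ₂ S ρ(Cr) j + cO` deviates from a `t`-free class constant by `≤ vol·s_K`, `Σ s_K < ∞`» — depends on
that `Cr` through the RATE radii `ρ_j = Cw·vol·(Cr θ′^j Λ^{K−j})` which steer `sliceCentre`.  A producer of (D) would
therefore have had to work uniformly in an unknown `Cr`.  This leaf removes the E-group from (D) altogether, BY KERNEL and
in the lineage's own technique (the composed tower rate): at a REFERENCE WITNESS — an admissible driving field `v₁` on which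
both runs' background maps return the reference backgrounds `U₁^A`, `U₁^B` of the (2.25)-normalisation (binder (F′),
STRUCTURAL, here a hypothesis; in the papers the E-terms of (2.25) are analytic on the small-field spaces
`U^c_j(X, α_{0,j}, α_{1,j})` of property (ii) below (2.27), p. 259 of [Balaban1988Convergent] (their radii `α_{0,j}`,
`α_{1,j}` are (2.28)), neighbourhoods of the unit configuration — a LOCATION remark, not a citation of a two-run
statement) — every E-factor `exp(E(X; g, U(v₁)) − E(X; g, U₁))` equals
`1`, so the one-run SIZE centring (binder (S)) read at `v₁` gives `|κ₁ j| ≤ S j`, and the two-run RATE centring produced from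
`URateUpTo K` + `Multiplicity` (`T4TermwiseBudget.rateSlice_of_uRateUpTo`) read at `v₁` gives
`|κ₂ j| ≤ Cw·vol·(Cr θ′^j Λ^{K−j}) = ρ j` — the centres bound ZERO within their own radii.  Hence
`|Σ_{j ≤ K} sliceCentre κ₁ κ₂ S ρ j| ≤ Σ_{j ≤ K} min(S j, ρ j) ≤ vol·max(Cw,1)(E + Cr)·Σ_{j+n=K} min(aⁿ, θ′^jΛⁿ)`
(`T4TermwiseBudget.sliceMin_le_eShape`), summable in `K` (`T4TowerRateComposition.summable_eBranch_poly`), for WHATEVER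
`Cr` the tower delivers.  What remains of (D) is HONESTLY RELOCATED to the other kinds: binder (O′) «the other kinds'
centre `cO K t τ` (vacuum-energy counter-terms of both runs incl. their `t`-dependence, large-field / R-kind normalisations,
boundary terms, run B's unmatched first ultraviolet step) deviates from a `t,τ`-free class constant `c₀ K` by `≤ vol·s_K`,
`Σ s_K < ∞`» — a statement that no longer mentions `Cr`, NOT PRINTED, and (§1) EQUIVALENT to (D) modulo the kernel-proved
E-branch (`otherKinds_dev_of_centreDeviation` is the converse direction).

## What this module adds (additive leaf; imports `T4TermwiseClosure` (gen 4) by name; nothing upstream is edited)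
§1 REAL ANALYSIS.  `abs_sum_sliceCentre_le`: centres bounding zero (`|κ₁ j| ≤ S j`, `|κ₂ j| ≤ ρ j`) give
   `|Σ sliceCentre| ≤ Σ min(S, ρ)`; `abs_centre_sub_le`: with `Σ min ≤ vol·r` and `|cO − c₀| ≤ vol·s` the term constant is
   within `vol·(r + s)` of `c₀`; `otherKinds_dev_of_centreDeviation`: conversely (D) ⇒ (O′) with `s + r`.
§2 THE WITNESS.  `sizeCentre_abs_le_of_witness`, `rateCentre_abs_le_of_witness`: at `v₁ ∈ Adm` with `U^A(v₁) = U₁^A`,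
   `U^B(v₁) = U₁^B` the (2.25)-shaped log-ratios vanish, so (S) gives `|κ₁ j| ≤ S j` and `URateUpTo K` + `Multiplicity`
   give `|κ₂ j| ≤ Cw·vol·(Cr θ^j Λ^{K−j})` for `j ≤ K`.
§3 PER TERM FAMILY (generality of `T4TermwiseBudget.termBudget_of_towerRate`).  `centreDeviation_of_witness`: (S), the
   tower rate, (M), (F′) and (O′) PRODUCE generation 3/4's binder `hdev` with deviation rate
   `max(Cw,1)(E + Cr_K)·Σ min(aⁿ, θ^jΛⁿ) + s_K`; `termBudget_of_towerRate_witness`: node U5's per-term budget with NO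
   H-U5b-1 binder on the E-group.
§4 PER FAMILY ALONG THE SPINE.  `goodClause_summable_of_nodes_witness`, `hybridNE7_of_nodes_witness`,
   `ne7_of_nodes_witness`: the binders of generation 4's `hybridNE7_of_nodes` / `ne7_of_nodes` with (D) REPLACED by
   (F′) + (O′); the tower's `Cr` now occurs only inside the delivered remainder
   `δ′_K = (max(Cw,1)(E + Cr)e_K + rO K) + (max(Cw,1)(E + Cr)e_K + s K)`, `e_K = Σ_{j+n=K} min(aⁿ, θ′^jΛⁿ)`, never in a
   premise.
§5 ALL STRINGS — THE CAPSTONE RE-KEYED.  `hasContinuumLimit_of_nodes_witness`: the node-U0 targets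
   `HasContinuumLimit Sc ∧ HasUniqueLimitPoints Sc ∧ LimitPointsAgree Sc` OUTRIGHT (no `∃ Cr`-guarded implication) from the
   string-independent tower data (T), the per-string binders (F)(S)(M)(O)(O′)(W)(L1-pos)(E1/E2) and the witness (F′)
   (`T4MatchingAssembly.hasContinuumLimit_of_hybridNE7`, one string at a time — a common `Cr` is no longer needed).

## Binder census of the capstone (every one a hypothesis; which are estimates)
(T) tower, string-independent, NOT PRINTED as two-run statements: `h9 hΛm hUL hG h5 hloc hgd hinj hbox hgA hgB` + signs and
the rate window `max(ω,θc) < θ′ < 1`, `θ₅, θ₃ ≤ θ′ ≤ Λ`, `0 < a < 1`.  (F) format `hfmtA hfmtB hint hsc hposO hoff`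
(STRUCTURAL: the (2.25)-shape of the E-group factors — LOCATION p. 259 of [Balaban1988Convergent]).  (F′) `hwit` the
reference witness (STRUCTURAL, NOT PRINTED as such).  (S) `hS hSle` one-run size centrings `≤ vol·E·a^{K−j}` (shape of
(2.43) p. 263, one run at a time — LOCATION).  (M) `hM` multiplicity with base `Λ`.  (O) `hO hRO hrO` other kinds' radii.
(O′) `hO'` / `hdevO` the other kinds' CENTRES against a `t,τ`-free class constant, `Summable s` — THE WHOLE OF WHAT IS LEFT
OF H-U5b-1, NOT PRINTED.  (W) `hW` `RelWeightBound` (NE7b both runs, NOT PRINTED; sibling seats).  (L1-pos) `hA hB`.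
(E1/E2) `hZA hZB` dictionary.  OUTPUT: node U0's three targets.  Non-vacuity: of the ledger-level binder set with
centres `0`, `T4TermwiseBudget.toy_termBudget_nonvacuous`; of the tower side, `T4TowerRateDischarge.toy_nodes_conclusion`;
§1 holds trivially at `κ₁ = κ₂ = 0`.  NO joint toy of (F′) with the functional (2.25) format is given in this leaf
(v1.1: one is `T4TermwiseCurrency.toy_rate_witness_nonvacuous`, on the currency-generic form of §4's ledger theorem).

## What is NOT delivered
The weight half (W); the R-kind two-run rate inside (O); the other kinds' centring (O′); the one-run inputs (F)(F′)(S)(M);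
any of the tower's node estimates (T).  The crux-typing checklist item (ii) is respected: every `∫` appears only inside the
format binders supplied by the caller, with integrability a named binder (`hint`).

References (LOCATIONS / TEMPLATE only; nothing here is cited as proving a binder): [King1986] C. King, The U(1) Higgs
model: I. The continuum limit, Commun. Math. Phys. 102 (1986) 649–677, (3.10)–(3.13) pp. 656–657 (template of NE7);
[Balaban1988Convergent] T. Bałaban, Convergent renormalization expansions for lattice gauge theories, Commun. Math. Phys.
119 (1988) 243–285, (2.25) p. 259, (2.43)–(2.46) p. 263 (locations of the one-run shapes and of the unit normalisation).
-/

open Finset MeasureTheory _root_.Filter _root_.Topology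

namespace Literature.MathematicalPhysics.QuantumFieldTheory.Balaban1983to89.T4TermwiseDeviation

open T4OutputRate T4RecentScale T4GoodClassBudget T4CauchySum T4TowerRateComposition T4TowerRateDischarge
  T4TermwiseBudget T4TermwiseClosure T4HybridMatching T4MatchingAssembly T4Crossover

/-! ## §1 Real analysis: centres that bound zero are within the slice radii of zero -/

section Slices

/-- If both per-slice centres bound ZERO within their radii (`|κ₁ j| ≤ S j`, `|κ₂ j| ≤ ρ j` for `j ≤ K`), the chosen
term constant of the E-group is within `Σ_{j ≤ K} min(S j, ρ j)` of zero (`T4GoodClassBudget.abs_sub_sliceCentre_le` at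
`y = 0`, summed). [folklore] -/
theorem abs_sum_sliceCentre_le {κ₁ κ₂ S ρ : ℕ → ℝ} {K : ℕ} (h₁ : ∀ j ≤ K, |κ₁ j| ≤ S j)
    (h₂ : ∀ j ≤ K, |κ₂ j| ≤ ρ j) :
    |∑ j ∈ range (K + 1), sliceCentre κ₁ κ₂ S ρ j| ≤ ∑ j ∈ range (K + 1), min (S j) (ρ j) := by
  refine (abs_sum_le_sum_abs _ _).trans (sum_le_sum fun j hj => ?_)
  have hjK : j ≤ K := Nat.le_of_lt_succ (mem_range.mp hj)
  have h := abs_sub_sliceCentre_le (κ₁ := κ₁) (κ₂ := κ₂) (S := S) (ρ := ρ) (j := j) (y := 0)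
    (by rw [zero_sub, abs_neg]; exact h₁ j hjK) (by rw [zero_sub, abs_neg]; exact h₂ j hjK)
  rwa [zero_sub, abs_neg] at h

/-- … so with `Σ_{j ≤ K} min(S j, ρ j) ≤ vol·r` (the crossover, `T4TermwiseBudget.sliceMin_le_eShape`) and the OTHER KINDS'
centre within `vol·s` of a class constant `c₀` (binder (O′)), the whole term constant `Σ_j sliceCentre … j + cO` is within
`vol·(r + s)` of `c₀` — generation 3/4's binder `hdev` (hazard H-U5b-1) with deviation rate `r + s`. [folklore] -/
theorem abs_centre_sub_le {κ₁ κ₂ S ρ : ℕ → ℝ} {K : ℕ} {cO c₀ vol r s : ℝ} (h₁ : ∀ j ≤ K, |κ₁ j| ≤ S j)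
    (h₂ : ∀ j ≤ K, |κ₂ j| ≤ ρ j) (hmin : ∑ j ∈ range (K + 1), min (S j) (ρ j) ≤ vol * r)
    (hO : |cO - c₀| ≤ vol * s) :
    |((∑ j ∈ range (K + 1), sliceCentre κ₁ κ₂ S ρ j) + cO) - c₀| ≤ vol * (r + s) := by
  have e : ((∑ j ∈ range (K + 1), sliceCentre κ₁ κ₂ S ρ j) + cO) - c₀
      = (∑ j ∈ range (K + 1), sliceCentre κ₁ κ₂ S ρ j) + (cO - c₀) := by ring
  rw [e, mul_add]
  exact (abs_add_le _ _).trans (add_le_add ((abs_sum_sliceCentre_le h₁ h₂).trans hmin) hO)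

/-- CONVERSELY, generation 4's binder (D) (the whole term constant within `vol·s` of `c₀`) implies (O′) with rate `r + s`
once the E-group's centres bound zero: modulo the kernel-proved E-branch the two binders are EQUIVALENT — this leaf adds
no strength to the hypothesis set, it relocates it. [folklore] -/
theorem otherKinds_dev_of_centreDeviation {κ₁ κ₂ S ρ : ℕ → ℝ} {K : ℕ} {cO c₀ vol r s : ℝ}
    (h₁ : ∀ j ≤ K, |κ₁ j| ≤ S j) (h₂ : ∀ j ≤ K, |κ₂ j| ≤ ρ j)
    (hmin : ∑ j ∈ range (K + 1), min (S j) (ρ j) ≤ vol * r)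
    (hdev : |((∑ j ∈ range (K + 1), sliceCentre κ₁ κ₂ S ρ j) + cO) - c₀| ≤ vol * s) :
    |cO - c₀| ≤ vol * (r + s) := by
  have e : cO - c₀ = (((∑ j ∈ range (K + 1), sliceCentre κ₁ κ₂ S ρ j) + cO) - c₀)
      - ∑ j ∈ range (K + 1), sliceCentre κ₁ κ₂ S ρ j := by ring
  rw [e, mul_add, add_comm (vol * r)]
  exact (abs_sub _ _).trans (add_le_add hdev ((abs_sum_sliceCentre_le h₁ h₂).trans hmin))

end Slices

/-! ## §2 The reference witness: at `U(v₁) = U₁` in both runs the centres bound zero -/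

section Witness

variable {C : Carriers} {V : Type*}

/-- AT A REFERENCE WITNESS THE SIZE CENTRE BOUNDS ZERO.  If some driving field `v₁` is mapped to the reference
backgrounds in both runs (`U^A(v₁) = U₁^A`, `U^B(v₁) = U₁^B`; binder (F′)), every (2.25)-shaped factor
`exp(E(X; g, U(v₁)) − E(X; g, U₁))` equals `1`, the slice log-ratios vanish, and the one-run size centring (binder (S)) read
at `v₁` says `|κ₁ j| ≤ S j`. [folklore] -/
theorem sizeCentre_abs_le_of_witness {EA : Functional C C.BgA} {EB : Functional C C.BgB} {gA gB : ℕ → ℝ}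
    {uA : V → C.BgA} {uB : V → C.BgB} {oneA : C.BgA} {oneB : C.BgB} {fac : Finset C.Dom} {κ₁ S : ℕ → ℝ}
    {K : ℕ} {v₁ : V} (hA : uA v₁ = oneA) (hB : uB v₁ = oneB)
    (hS : ∀ j ≤ K, |(∑ X ∈ fac with C.scale X = j,
        (Real.log (Real.exp (EB gB (uB v₁) X - EB gB oneB X))
          - Real.log (Real.exp (EA gA (uA v₁) X - EA gA oneA X)))) - κ₁ j| ≤ S j) :
    ∀ j ≤ K, |κ₁ j| ≤ S j := fun j hj => by
  have h0 : (∑ X ∈ fac with C.scale X = j,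
      (Real.log (Real.exp (EB gB (uB v₁) X - EB gB oneB X))
        - Real.log (Real.exp (EA gA (uA v₁) X - EA gA oneA X)))) = 0 :=
    sum_eq_zero fun X _ => by simp only [hA, hB, sub_self, Real.exp_zero, Real.log_one]
  have h := hS j hj
  rwa [h0, zero_sub, abs_neg] at h

/-- AT A REFERENCE WITNESS THE RATE CENTRE BOUNDS ZERO.  With `v₁ ∈ Adm` as above, the composed two-run tower rate
`URateUpTo K` (lineage t4-ne7-p1, node U3's output up to cutoff `K`, NOT PRINTED) and `Multiplicity` of the ledger
(NOT PRINTED for a two-run ledger) — i.e. `T4TermwiseBudget.rateSlice_of_uRateUpTo` read at `v₁` — bound the RATE CENTRE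
ITSELF: `|Σ_{scale X = j} −(E^B(X; g^B, U₁^B) − E^A(X; g^A, U₁^A))| ≤ Cw·vol·(Cr θ^j Λ^{K−j})` for `j ≤ K`. [folklore] -/
theorem rateCentre_abs_le_of_witness {EA : Functional C C.BgA} {EB : Functional C C.BgB} {gA gB : ℕ → ℝ}
    {uA : V → C.BgA} {uB : V → C.BgB} {Adm : Set V} {oneA : C.BgA} {oneB : C.BgB} {fac : Finset C.Dom}
    {Cr θ κ Cw vol Λ : ℝ} {K : ℕ} {v₁ : V} (hv₁ : v₁ ∈ Adm) (hA : uA v₁ = oneA) (hB : uB v₁ = oneB)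
    (hU : URateUpTo K EA EB gA gB uA uB Adm Cr θ κ) (hfac : ∀ X ∈ fac, C.scale X ≤ K)
    (hM : Multiplicity fac C.scale (fun X => Real.exp (-(κ * C.d X))) Cw vol Λ K) (hCr : 0 ≤ Cr) (hθ : 0 ≤ θ) :
    ∀ j ≤ K, |∑ X ∈ fac with C.scale X = j, (-(EB gB oneB X - EA gA oneA X))|
      ≤ Cw * vol * (Cr * θ ^ j * Λ ^ (K - j)) := fun j hj => by
  have h0 : (∑ X ∈ fac with C.scale X = j,
      (Real.log (Real.exp (EB gB (uB v₁) X - EB gB oneB X))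
        - Real.log (Real.exp (EA gA (uA v₁) X - EA gA oneA X)))) = 0 :=
    sum_eq_zero fun X _ => by simp only [hA, hB, sub_self, Real.exp_zero, Real.log_one]
  have h := rateSlice_of_uRateUpTo hU oneA oneB hfac hM hCr hθ hv₁ hj
  rwa [h0, zero_sub, abs_neg] at h

end Witness

/-! ## §3 Per term family: the binder `hdev` of generations 3/4 PRODUCED from (S), the tower rate, (M), (F′), (O′) -/

section TowerFamily

variable {C : Carriers} {ι V : Type*} [DecidableEq ι] [MeasurableSpace V] {l₀ vol : ℝ} {T : ℕ → Finset ι}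
  {Bad : ℕ → ℝ → Finset ι} {A B : ℕ → ℝ → ι → ℝ} {μ : ℕ → ℝ → ι → Measure V} {Adm : ℕ → ℝ → ι → Set V}
  {fac : ℕ → ℝ → ι → Finset C.Dom} {EA : Functional C C.BgA} {EB : Functional C C.BgB} {gA gB : ℕ → ℕ → ℝ}
  {uA : ℕ → ℝ → ι → V → C.BgA} {uB : ℕ → ℝ → ι → V → C.BgB} {oneA : C.BgA} {oneB : C.BgB}
  {oA oB : ℕ → ℝ → ι → V → ℝ} {κ₁ S : ℕ → ℝ → ι → ℕ → ℝ} {cO RO : ℕ → ℝ → ι → ℝ} {c₀ s rO Cr : ℕ → ℝ}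
  {Cw E a θ κ Λ : ℝ}

omit [MeasurableSpace V] in
/-- **THE E-GROUP'S SHARE OF HAZARD H-U5b-1, DISCHARGED.**  For the term format of
`T4TermwiseBudget.termBudget_of_towerRate` (E-factors in the (2.25) shape, creation scales `≤ K`), the one-run SIZE
centrings (S) with `S ≤ vol·E·a^{K−j}`, the composed tower rate `URateUpTo K` with constant `Cr K` (NOT PRINTED),
`Multiplicity` (NOT PRINTED), a REFERENCE WITNESS in every good term's admissible set (F′), and the OTHER KINDS' CENTRES
within `vol·s_K` of a `t,τ`-free class constant (O′, NOT PRINTED): generation 3/4's binder `hdev` holds with deviation rate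
`max(Cw,1)·(E + Cr K)·Σ_{j+n=K} min(aⁿ, θ^jΛⁿ) + s K`. [folklore] -/
theorem centreDeviation_of_witness
    (hsc : ∀ K t, |t| ≤ l₀ → ∀ τ ∈ T K \ Bad K t, ∀ X ∈ fac K t τ, C.scale X ≤ K)
    (hS : ∀ K t, |t| ≤ l₀ → ∀ τ ∈ T K \ Bad K t, ∀ v ∈ Adm K t τ, ∀ j ≤ K,
      |(∑ X ∈ fac K t τ with C.scale X = j,
          (Real.log (Real.exp (EB (gB K) (uB K t τ v) X - EB (gB K) oneB X))
            - Real.log (Real.exp (EA (gA K) (uA K t τ v) X - EA (gA K) oneA X)))) - κ₁ K t τ j| ≤ S K t τ j)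
    (hU : ∀ K t, |t| ≤ l₀ → ∀ τ ∈ T K \ Bad K t,
      URateUpTo K EA EB (gA K) (gB K) (uA K t τ) (uB K t τ) (Adm K t τ) (Cr K) θ κ)
    (hM : ∀ K t, |t| ≤ l₀ → ∀ τ ∈ T K \ Bad K t,
      Multiplicity (fac K t τ) C.scale (fun X => Real.exp (-(κ * C.d X))) Cw vol Λ K)
    (hwit : ∀ K t, |t| ≤ l₀ → ∀ τ ∈ T K \ Bad K t, ∃ v₁ ∈ Adm K t τ, uA K t τ v₁ = oneA ∧ uB K t τ v₁ = oneB)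
    (hvol : 0 ≤ vol) (hE : 0 ≤ E) (ha : 0 ≤ a) (hθ : 0 ≤ θ) (hΛ : 0 ≤ Λ) (hCr : ∀ K, 0 ≤ Cr K)
    (hSle : ∀ K t, |t| ≤ l₀ → ∀ τ ∈ T K \ Bad K t, ∀ j ≤ K, S K t τ j ≤ vol * (E * a ^ (K - j)))
    (hO' : ∀ K t, |t| ≤ l₀ → ∀ τ ∈ T K \ Bad K t, |cO K t τ - c₀ K| ≤ vol * s K) :
    ∀ K t, |t| ≤ l₀ → ∀ τ ∈ T K \ Bad K t,
      |((∑ j ∈ range (K + 1), sliceCentre (κ₁ K t τ)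
          (fun j => ∑ X ∈ fac K t τ with C.scale X = j, (-(EB (gB K) oneB X - EA (gA K) oneA X)))
          (S K t τ) (fun j => Cw * vol * (Cr K * θ ^ j * Λ ^ (K - j))) j) + cO K t τ) - c₀ K|
        ≤ vol * (max Cw 1 * ((E + Cr K) * ∑ x ∈ antidiagonal K, min (a ^ x.2) (θ ^ x.1 * Λ ^ x.2)) + s K) := by
  intro K t ht τ hτ
  obtain ⟨v₁, hv₁, hA1, hB1⟩ := hwit K t ht τ hτ
  have h₁ := sizeCentre_abs_le_of_witness (EA := EA) (EB := EB) (gA := gA K) (gB := gB K) (uA := uA K t τ)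
    (uB := uB K t τ) (fac := fac K t τ) (κ₁ := κ₁ K t τ) (S := S K t τ) hA1 hB1 (hS K t ht τ hτ v₁ hv₁)
  have h₂ := rateCentre_abs_le_of_witness (fac := fac K t τ) hv₁ hA1 hB1 (hU K t ht τ hτ) (hsc K t ht τ hτ)
    (hM K t ht τ hτ) (hCr K) hθ
  exact abs_centre_sub_le h₁ h₂
    (sliceMin_le_eShape hvol hE ha hθ hΛ (hCr K) (hSle K t ht τ hτ) (fun _ _ => le_rfl)) (hO' K t ht τ hτ)

/-- **NODE U5's PER-TERM BUDGET FED BY THE TOWER RATE, WITH NO H-U5b-1 BINDER ON THE E-GROUP**: as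
`T4TermwiseBudget.termBudget_of_towerRate`, its binder `hdev` replaced by the witness (F′) and the other kinds' centring
(O′); the budget's deviation slot becomes `max(Cw,1)·(E + Cr K)·Σ min(aⁿ, θ^jΛⁿ) + s K`. [folklore] -/
theorem termBudget_of_towerRate_witness
    (hfmtA : ∀ K t τ, A K t τ = ∫ v, (∏ X ∈ fac K t τ,
      Real.exp (EA (gA K) (uA K t τ v) X - EA (gA K) oneA X)) * oA K t τ v ∂(μ K t τ))
    (hfmtB : ∀ K t τ, B K t τ = ∫ v, (∏ X ∈ fac K t τ,
      Real.exp (EB (gB K) (uB K t τ v) X - EB (gB K) oneB X)) * oB K t τ v ∂(μ K t τ))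
    (hint : ∀ K t, |t| ≤ l₀ → ∀ τ ∈ T K \ Bad K t,
      Integrable (fun v => (∏ X ∈ fac K t τ, Real.exp (EA (gA K) (uA K t τ v) X - EA (gA K) oneA X)) *
        oA K t τ v) (μ K t τ) ∧
      Integrable (fun v => (∏ X ∈ fac K t τ, Real.exp (EB (gB K) (uB K t τ v) X - EB (gB K) oneB X)) *
        oB K t τ v) (μ K t τ))
    (hsc : ∀ K t, |t| ≤ l₀ → ∀ τ ∈ T K \ Bad K t, ∀ X ∈ fac K t τ, C.scale X ≤ K)
    (hposO : ∀ K t, |t| ≤ l₀ → ∀ τ ∈ T K \ Bad K t, ∀ v ∈ Adm K t τ, 0 < oA K t τ v ∧ 0 < oB K t τ v)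
    (hoff : ∀ K t, |t| ≤ l₀ → ∀ τ ∈ T K \ Bad K t, ∀ v, v ∉ Adm K t τ →
      (∏ X ∈ fac K t τ, Real.exp (EA (gA K) (uA K t τ v) X - EA (gA K) oneA X)) * oA K t τ v = 0 ∧
      (∏ X ∈ fac K t τ, Real.exp (EB (gB K) (uB K t τ v) X - EB (gB K) oneB X)) * oB K t τ v = 0)
    (hS : ∀ K t, |t| ≤ l₀ → ∀ τ ∈ T K \ Bad K t, ∀ v ∈ Adm K t τ, ∀ j ≤ K,
      |(∑ X ∈ fac K t τ with C.scale X = j,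
          (Real.log (Real.exp (EB (gB K) (uB K t τ v) X - EB (gB K) oneB X))
            - Real.log (Real.exp (EA (gA K) (uA K t τ v) X - EA (gA K) oneA X)))) - κ₁ K t τ j| ≤ S K t τ j)
    (hU : ∀ K t, |t| ≤ l₀ → ∀ τ ∈ T K \ Bad K t,
      URateUpTo K EA EB (gA K) (gB K) (uA K t τ) (uB K t τ) (Adm K t τ) (Cr K) θ κ)
    (hM : ∀ K t, |t| ≤ l₀ → ∀ τ ∈ T K \ Bad K t,
      Multiplicity (fac K t τ) C.scale (fun X => Real.exp (-(κ * C.d X))) Cw vol Λ K)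
    (hwit : ∀ K t, |t| ≤ l₀ → ∀ τ ∈ T K \ Bad K t, ∃ v₁ ∈ Adm K t τ, uA K t τ v₁ = oneA ∧ uB K t τ v₁ = oneB)
    (hO : ∀ K t, |t| ≤ l₀ → ∀ τ ∈ T K \ Bad K t, ∀ v ∈ Adm K t τ,
      |Real.log (oB K t τ v) - Real.log (oA K t τ v) - cO K t τ| ≤ RO K t τ)
    (hvol : 0 ≤ vol) (hE : 0 ≤ E) (ha : 0 ≤ a) (hθ : 0 ≤ θ) (hΛ : 0 ≤ Λ) (hCr : ∀ K, 0 ≤ Cr K)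
    (hSle : ∀ K t, |t| ≤ l₀ → ∀ τ ∈ T K \ Bad K t, ∀ j ≤ K, S K t τ j ≤ vol * (E * a ^ (K - j)))
    (hRO : ∀ K t, |t| ≤ l₀ → ∀ τ ∈ T K \ Bad K t, RO K t τ ≤ vol * rO K)
    (hO' : ∀ K t, |t| ≤ l₀ → ∀ τ ∈ T K \ Bad K t, |cO K t τ - c₀ K| ≤ vol * s K) :
    TermBudget l₀ vol T A B Bad
      (fun K t τ => (∑ j ∈ range (K + 1), sliceCentre (κ₁ K t τ)
          (fun j => ∑ X ∈ fac K t τ with C.scale X = j, (-(EB (gB K) oneB X - EA (gA K) oneA X)))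
          (S K t τ) (fun j => Cw * vol * (Cr K * θ ^ j * Λ ^ (K - j))) j) + cO K t τ)
      (fun K t τ => (∑ j ∈ range (K + 1), min (S K t τ j) (Cw * vol * (Cr K * θ ^ j * Λ ^ (K - j)))) + RO K t τ)
      c₀ (fun K => max Cw 1 * ((E + Cr K) * ∑ x ∈ antidiagonal K, min (a ^ x.2) (θ ^ x.1 * Λ ^ x.2)) + rO K)
      (fun K => max Cw 1 * ((E + Cr K) * ∑ x ∈ antidiagonal K, min (a ^ x.2) (θ ^ x.1 * Λ ^ x.2)) + s K) :=
  termBudget_of_towerRate hfmtA hfmtB hint hsc hposO hoff hS hU hM hO hvol hE ha hθ hΛ hCr hSle hRO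
    (centreDeviation_of_witness hsc hS hU hM hwit hvol hE ha hθ hΛ hCr hSle hO')

end TowerFamily

/-! ## §4 Per family along the spine: generation 4's theorems with (D) replaced by (F′) + (O′) -/

section Spine

open T4EtaRateMin (Readings LocalRate)
open T4RateLiaison (GaugeDominated)

variable {C : Carriers} {ι X : Type} [MeasurableSpace ι] {σ : Type*} [DecidableEq σ] {l₀ vol : ℝ}
  {T : ℕ → Finset σ} {Bad : ℕ → ℝ → Finset σ} {A B : ℕ → ℝ → σ → ℝ} {μ : ℕ → ℝ → σ → Measure ι}
  {fac : ℕ → ℝ → σ → Finset C.Dom} {R : Readings ι X} {W : Set (ℕ → ℝ)} {EA : Functional C C.BgA}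
  {EB : Functional C C.BgB} {κ θ₅ C₅ C₉ ω θc Cd γ C₃ θ₃ P θ' : ℝ} {q : ℕ} {Λm : ℕ → ℕ → ℝ}
  {CU : (ℕ → ℝ) → ℕ → ℝ} {g : ℕ → ℕ → ℝ} {uA : ℕ → ι → C.BgA} {uB : ℕ → ι → C.BgB} {oneA : C.BgA} {oneB : C.BgB}
  {oA oB : ℕ → ℝ → σ → ι → ℝ} {κ₁ S : ℕ → ℝ → σ → ℕ → ℝ} {cO RO : ℕ → ℝ → σ → ℝ} {rO Wb : ℕ → ℝ} {Cw E a Λ : ℝ}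

/-- **THE TERM-WISE ROUTE'S GOOD-CLASS HALF WITH `Summable δ`, NO H-U5b-1 BINDER ON THE E-GROUP.**  INPUTS BY NAME
(none printed as a two-run statement): the binders of `T4TermwiseBudget.goodClause_summable_of_nodes` verbatim — the
sibling nodes' typed outputs (NE9 + fading memory, Lipschitz-in-the-background with polynomial growth, NE5, NE3 as
`LocalRate` + `GaugeDominated`, node U2's injected coupling rate on the printed box, both runs' couplings in the window),
the term format (F), one-run sizes (S), multiplicity (M), the other kinds' radii (O) with `Summable rO` — PLUS the
reference witness (F′) «for every `K` some `v₁ ∈ R.dom` with `U^A_K(v₁) = U₁^A`, `U^B_K(v₁) = U₁^B`» and, in place of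
hazard H-U5b-1 on the E-group, the other kinds' CENTRING (O′) «`|cO K t τ − c₀ K| ≤ vol·s_K` on the good terms,
`Summable s`».  OUTPUT: for the tower's `Cr ≥ 0` (now only INSIDE the delivered remainder) the good clause with
`δ′_K = (max(Cw,1)(E + Cr)e_K + rO K) + (max(Cw,1)(E + Cr)e_K + s K)`, `e_K = Σ_{j+n=K} min(aⁿ, θ′^jΛⁿ)`, and
`Summable δ′`. [folklore] -/
theorem goodClause_summable_of_nodes_witness
    (h9 : NE9 EA W κ Λm) (hΛm : FadingMemory C₉ ω Λm) (hω : 0 ≤ ω)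
    (hUL : LipBackground EA W κ CU) (hG : PolyLipGrowth CU g P q) (hP : 0 ≤ P)
    (h5 : NE5 EA EB W κ θ₅ C₅) (hθ₅ : 0 ≤ θ₅) (hC₅ : 0 ≤ C₅)
    (hloc : LocalRate R C₃ θ₃) (hC₃ : 0 ≤ C₃) (hθ₃ : 0 ≤ θ₃) (hθ₃1 : θ₃ < 1) (hgd : GaugeDominated R uA uB)
    (hinj : InjectedRate Cd 0 θc (fun K j => T4CouplingMatching.disc (g K) (g (K + 1)) j)) (hCd : 0 ≤ Cd)
    (hθc : 0 ≤ θc) (hbox : ∀ K i, i ≤ K → 0 < g K i ∧ g K i ≤ γ)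
    (hgA : ∀ K, g K ∈ W) (hgB : ∀ K, (fun i => g (K + 1) (i + 1)) ∈ W)
    (hθ' : max ω θc < θ') (hθ₅' : θ₅ ≤ θ') (hθ₃' : θ₃ ≤ θ')
    (hfmtA : ∀ K t τ, A K t τ = ∫ v, (∏ X ∈ fac K t τ,
      Real.exp (EA (g K) (uA K v) X - EA (g K) oneA X)) * oA K t τ v ∂(μ K t τ))
    (hfmtB : ∀ K t τ, B K t τ = ∫ v, (∏ X ∈ fac K t τ,
      Real.exp (EB (fun i => g (K + 1) (i + 1)) (uB K v) X - EB (fun i => g (K + 1) (i + 1)) oneB X)) *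
        oB K t τ v ∂(μ K t τ))
    (hint : ∀ K t, |t| ≤ l₀ → ∀ τ ∈ T K \ Bad K t,
      Integrable (fun v => (∏ X ∈ fac K t τ, Real.exp (EA (g K) (uA K v) X - EA (g K) oneA X)) *
        oA K t τ v) (μ K t τ) ∧
      Integrable (fun v => (∏ X ∈ fac K t τ,
        Real.exp (EB (fun i => g (K + 1) (i + 1)) (uB K v) X - EB (fun i => g (K + 1) (i + 1)) oneB X)) *
        oB K t τ v) (μ K t τ))
    (hsc : ∀ K t, |t| ≤ l₀ → ∀ τ ∈ T K \ Bad K t, ∀ X ∈ fac K t τ, C.scale X ≤ K)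
    (hposO : ∀ K t, |t| ≤ l₀ → ∀ τ ∈ T K \ Bad K t, ∀ v ∈ R.dom, 0 < oA K t τ v ∧ 0 < oB K t τ v)
    (hoff : ∀ K t, |t| ≤ l₀ → ∀ τ ∈ T K \ Bad K t, ∀ v, v ∉ R.dom →
      (∏ X ∈ fac K t τ, Real.exp (EA (g K) (uA K v) X - EA (g K) oneA X)) * oA K t τ v = 0 ∧
      (∏ X ∈ fac K t τ,
        Real.exp (EB (fun i => g (K + 1) (i + 1)) (uB K v) X - EB (fun i => g (K + 1) (i + 1)) oneB X)) *
        oB K t τ v = 0)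
    (hS : ∀ K t, |t| ≤ l₀ → ∀ τ ∈ T K \ Bad K t, ∀ v ∈ R.dom, ∀ j ≤ K,
      |(∑ X ∈ fac K t τ with C.scale X = j,
          (Real.log (Real.exp (EB (fun i => g (K + 1) (i + 1)) (uB K v) X
              - EB (fun i => g (K + 1) (i + 1)) oneB X))
            - Real.log (Real.exp (EA (g K) (uA K v) X - EA (g K) oneA X)))) - κ₁ K t τ j| ≤ S K t τ j)
    (hM : ∀ K t, |t| ≤ l₀ → ∀ τ ∈ T K \ Bad K t,
      Multiplicity (fac K t τ) C.scale (fun X => Real.exp (-(κ * C.d X))) Cw vol Λ K)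
    (hwit : ∀ K, ∃ v₁ ∈ R.dom, uA K v₁ = oneA ∧ uB K v₁ = oneB)
    (hO : ∀ K t, |t| ≤ l₀ → ∀ τ ∈ T K \ Bad K t, ∀ v ∈ R.dom,
      |Real.log (oB K t τ v) - Real.log (oA K t τ v) - cO K t τ| ≤ RO K t τ)
    (hvol : 0 ≤ vol) (hE : 0 ≤ E) (ha0 : 0 < a) (ha1 : a < 1) (hθ'1 : θ' < 1) (hθ'Λ : θ' ≤ Λ)
    (hSle : ∀ K t, |t| ≤ l₀ → ∀ τ ∈ T K \ Bad K t, ∀ j ≤ K, S K t τ j ≤ vol * (E * a ^ (K - j)))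
    (hRO : ∀ K t, |t| ≤ l₀ → ∀ τ ∈ T K \ Bad K t, RO K t τ ≤ vol * rO K) (hrO : Summable rO) :
    ∃ Cr : ℝ, 0 ≤ Cr ∧ ∀ c₀ s : ℕ → ℝ, Summable s →
      (∀ K t, |t| ≤ l₀ → ∀ τ ∈ T K \ Bad K t, |cO K t τ - c₀ K| ≤ vol * s K) →
      GoodClause l₀ vol T A B Bad
          (fun K => (max Cw 1 * ((E + Cr) * ∑ x ∈ antidiagonal K, min (a ^ x.2) (θ' ^ x.1 * Λ ^ x.2)) + rO K)
            + (max Cw 1 * ((E + Cr) * ∑ x ∈ antidiagonal K, min (a ^ x.2) (θ' ^ x.1 * Λ ^ x.2)) + s K)) ∧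
        Summable (fun K => (max Cw 1 * ((E + Cr) * ∑ x ∈ antidiagonal K, min (a ^ x.2) (θ' ^ x.1 * Λ ^ x.2))
            + rO K) + (max Cw 1 * ((E + Cr) * ∑ x ∈ antidiagonal K, min (a ^ x.2) (θ' ^ x.1 * Λ ^ x.2))
            + s K)) := by
  -- the tower's rate (gen 2, `T4TowerRateDischarge.uRateUpTo_of_nodes`)
  obtain ⟨a₀, ha₀, hUK⟩ := uRateUpTo_of_nodes h9 hΛm hω hUL hG hP h5 hθ₅ hC₅ hloc hC₃ hθ₃ hθ₃1 hgd hinj hCd hθc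
    hbox hgA hgB hθ' hθ₅' hθ₃'
  have hθ'0 : 0 < θ' := lt_of_le_of_lt (hθc.trans (le_max_right ω θc)) hθ'
  have hΛ : 0 ≤ Λ := hθ'0.le.trans hθ'Λ
  have hC₉ : 0 ≤ C₉ := fadingMemory_const_nonneg hΛm
  have hD : 0 ≤ γ ^ 3 * Cd := mul_nonneg (pow_nonneg (box_nonneg hbox) 3) hCd
  set Cr : ℝ := a₀ + C₉ * (γ ^ 3 * Cd) * (θ' / (θ' - max ω θc)) + C₅ with hCr_def
  have hCr : 0 ≤ Cr :=
    add_nonneg (add_nonneg ha₀ (mul_nonneg (mul_nonneg hC₉ hD) (div_nonneg hθ'0.le (sub_pos.mpr hθ').le))) hC₅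
  have hsumE : Summable (fun K : ℕ => (E + Cr) * ∑ x ∈ antidiagonal K, min (a ^ x.2) (θ' ^ x.1 * Λ ^ x.2)) := by
    refine (summable_eBranch_poly (p := 0) hE hCr ha0 ha1 hθ'0 hθ'1 hθ'Λ).congr fun K => ?_
    rw [pow_zero, mul_one]
  refine ⟨Cr, hCr, fun c₀ s hs hO' => ?_⟩
  -- §3: the per-term budget fed by the tower rate, the E-group's share of H-U5b-1 discharged at the witness
  have hTB := termBudget_of_towerRate_witness (gA := g) (gB := fun K i => g (K + 1) (i + 1))
    (uA := fun K _ _ => uA K) (uB := fun K _ _ => uB K) (Adm := fun _ _ _ => R.dom) (Cr := fun _ => Cr)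
    hfmtA hfmtB hint hsc hposO hoff hS (fun K t _ τ _ => hUK K) hM (fun K _ _ _ _ => hwit K) hO hvol hE ha0.le
    hθ'0.le hΛ (fun _ => hCr) hSle hRO hO'
  exact goodClause_summable_of_ledgerBudget (Cr := fun _ => Cr) hTB hsumE hrO ((hsumE.mul_left (max Cw 1)).add hs)

/-- **THE TERM-WISE ROUTE CLOSED INTO THE HYBRID SHAPE, NO H-U5b-1 BINDER ON THE E-GROUP**: as
`T4TermwiseClosure.hybridNE7_of_nodes` — PLUS NE7's other half, the weight budget `T4WeightBudget.RelWeightBound`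
(binder (W), sibling seats' output, NOT PRINTED) and non-negativity of every term (L1-pos) — with (D) replaced by the
witness (F′) and the other kinds' centring (O′): `T4MatchingAssembly.HybridNE7` with ZERO shells and remainder `δ′`
(`hybridNE7_noShell`). [folklore] -/
theorem hybridNE7_of_nodes_witness
    (h9 : NE9 EA W κ Λm) (hΛm : FadingMemory C₉ ω Λm) (hω : 0 ≤ ω)
    (hUL : LipBackground EA W κ CU) (hG : PolyLipGrowth CU g P q) (hP : 0 ≤ P)
    (h5 : NE5 EA EB W κ θ₅ C₅) (hθ₅ : 0 ≤ θ₅) (hC₅ : 0 ≤ C₅)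
    (hloc : LocalRate R C₃ θ₃) (hC₃ : 0 ≤ C₃) (hθ₃ : 0 ≤ θ₃) (hθ₃1 : θ₃ < 1) (hgd : GaugeDominated R uA uB)
    (hinj : InjectedRate Cd 0 θc (fun K j => T4CouplingMatching.disc (g K) (g (K + 1)) j)) (hCd : 0 ≤ Cd)
    (hθc : 0 ≤ θc) (hbox : ∀ K i, i ≤ K → 0 < g K i ∧ g K i ≤ γ)
    (hgA : ∀ K, g K ∈ W) (hgB : ∀ K, (fun i => g (K + 1) (i + 1)) ∈ W)
    (hθ' : max ω θc < θ') (hθ₅' : θ₅ ≤ θ') (hθ₃' : θ₃ ≤ θ')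
    (hfmtA : ∀ K t τ, A K t τ = ∫ v, (∏ X ∈ fac K t τ,
      Real.exp (EA (g K) (uA K v) X - EA (g K) oneA X)) * oA K t τ v ∂(μ K t τ))
    (hfmtB : ∀ K t τ, B K t τ = ∫ v, (∏ X ∈ fac K t τ,
      Real.exp (EB (fun i => g (K + 1) (i + 1)) (uB K v) X - EB (fun i => g (K + 1) (i + 1)) oneB X)) *
        oB K t τ v ∂(μ K t τ))
    (hint : ∀ K t, |t| ≤ l₀ → ∀ τ ∈ T K \ Bad K t,
      Integrable (fun v => (∏ X ∈ fac K t τ, Real.exp (EA (g K) (uA K v) X - EA (g K) oneA X)) *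
        oA K t τ v) (μ K t τ) ∧
      Integrable (fun v => (∏ X ∈ fac K t τ,
        Real.exp (EB (fun i => g (K + 1) (i + 1)) (uB K v) X - EB (fun i => g (K + 1) (i + 1)) oneB X)) *
        oB K t τ v) (μ K t τ))
    (hsc : ∀ K t, |t| ≤ l₀ → ∀ τ ∈ T K \ Bad K t, ∀ X ∈ fac K t τ, C.scale X ≤ K)
    (hposO : ∀ K t, |t| ≤ l₀ → ∀ τ ∈ T K \ Bad K t, ∀ v ∈ R.dom, 0 < oA K t τ v ∧ 0 < oB K t τ v)
    (hoff : ∀ K t, |t| ≤ l₀ → ∀ τ ∈ T K \ Bad K t, ∀ v, v ∉ R.dom →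
      (∏ X ∈ fac K t τ, Real.exp (EA (g K) (uA K v) X - EA (g K) oneA X)) * oA K t τ v = 0 ∧
      (∏ X ∈ fac K t τ,
        Real.exp (EB (fun i => g (K + 1) (i + 1)) (uB K v) X - EB (fun i => g (K + 1) (i + 1)) oneB X)) *
        oB K t τ v = 0)
    (hS : ∀ K t, |t| ≤ l₀ → ∀ τ ∈ T K \ Bad K t, ∀ v ∈ R.dom, ∀ j ≤ K,
      |(∑ X ∈ fac K t τ with C.scale X = j,
          (Real.log (Real.exp (EB (fun i => g (K + 1) (i + 1)) (uB K v) X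
              - EB (fun i => g (K + 1) (i + 1)) oneB X))
            - Real.log (Real.exp (EA (g K) (uA K v) X - EA (g K) oneA X)))) - κ₁ K t τ j| ≤ S K t τ j)
    (hM : ∀ K t, |t| ≤ l₀ → ∀ τ ∈ T K \ Bad K t,
      Multiplicity (fac K t τ) C.scale (fun X => Real.exp (-(κ * C.d X))) Cw vol Λ K)
    (hwit : ∀ K, ∃ v₁ ∈ R.dom, uA K v₁ = oneA ∧ uB K v₁ = oneB)
    (hO : ∀ K t, |t| ≤ l₀ → ∀ τ ∈ T K \ Bad K t, ∀ v ∈ R.dom,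
      |Real.log (oB K t τ v) - Real.log (oA K t τ v) - cO K t τ| ≤ RO K t τ)
    (hvol : 0 ≤ vol) (hE : 0 ≤ E) (ha0 : 0 < a) (ha1 : a < 1) (hθ'1 : θ' < 1) (hθ'Λ : θ' ≤ Λ)
    (hSle : ∀ K t, |t| ≤ l₀ → ∀ τ ∈ T K \ Bad K t, ∀ j ≤ K, S K t τ j ≤ vol * (E * a ^ (K - j)))
    (hRO : ∀ K t, |t| ≤ l₀ → ∀ τ ∈ T K \ Bad K t, RO K t τ ≤ vol * rO K) (hrO : Summable rO)
    (hW : T4WeightBudget.RelWeightBound l₀ T A B Bad Wb)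
    (hA : ∀ K t, |t| ≤ l₀ → ∀ τ ∈ T K, 0 ≤ A K t τ) (hB : ∀ K t, |t| ≤ l₀ → ∀ τ ∈ T K, 0 ≤ B K t τ) :
    ∃ Cr : ℝ, 0 ≤ Cr ∧ ∀ c₀ s : ℕ → ℝ, Summable s →
      (∀ K t, |t| ≤ l₀ → ∀ τ ∈ T K \ Bad K t, |cO K t τ - c₀ K| ≤ vol * s K) →
      HybridNE7 l₀ vol T A B Bad Wb (fun _ _ _ => 0) (fun _ _ _ => 0) (fun _ => 0)
        (fun K => (max Cw 1 * ((E + Cr) * ∑ x ∈ antidiagonal K, min (a ^ x.2) (θ' ^ x.1 * Λ ^ x.2)) + rO K)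
          + (max Cw 1 * ((E + Cr) * ∑ x ∈ antidiagonal K, min (a ^ x.2) (θ' ^ x.1 * Λ ^ x.2)) + s K)) := by
  obtain ⟨Cr, hCr, h⟩ := goodClause_summable_of_nodes_witness h9 hΛm hω hUL hG hP h5 hθ₅ hC₅ hloc hC₃ hθ₃ hθ₃1
    hgd hinj hCd hθc hbox hgA hgB hθ' hθ₅' hθ₃' hfmtA hfmtB hint hsc hposO hoff hS hM hwit hO hvol hE ha0 ha1 hθ'1
    hθ'Λ hSle hRO hrO
  refine ⟨Cr, hCr, fun c₀ s hs hO' => ?_⟩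
  obtain ⟨hgood, hsum⟩ := h c₀ s hs hO'
  exact hybridNE7_noShell hW hA hB hsum hgood

/-- **NE7 ITSELF (node U5's output `T4CauchySum.MatchingModConstants`) AND NODE U6, NO H-U5b-1 BINDER ON THE E-GROUP**:
as `T4TermwiseClosure.ne7_of_nodes` with (D) replaced by (F′) + (O′) — the matching modulo `t`-independent constants with
the HYBRID remainder `hybridDelta vol δ′ Wb`, its summability, the Cauchy property of every generating function on
`|t| ≤ l₀` and uniform convergence there (`T4GoodClassBudget.cauchy_of_goodClause`).  CONDITIONAL on every binder
named; NE7 is NOT PRINTED. [folklore] -/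
theorem ne7_of_nodes_witness {Z : ℕ → ℝ → ℝ}
    (h9 : NE9 EA W κ Λm) (hΛm : FadingMemory C₉ ω Λm) (hω : 0 ≤ ω)
    (hUL : LipBackground EA W κ CU) (hG : PolyLipGrowth CU g P q) (hP : 0 ≤ P)
    (h5 : NE5 EA EB W κ θ₅ C₅) (hθ₅ : 0 ≤ θ₅) (hC₅ : 0 ≤ C₅)
    (hloc : LocalRate R C₃ θ₃) (hC₃ : 0 ≤ C₃) (hθ₃ : 0 ≤ θ₃) (hθ₃1 : θ₃ < 1) (hgd : GaugeDominated R uA uB)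
    (hinj : InjectedRate Cd 0 θc (fun K j => T4CouplingMatching.disc (g K) (g (K + 1)) j)) (hCd : 0 ≤ Cd)
    (hθc : 0 ≤ θc) (hbox : ∀ K i, i ≤ K → 0 < g K i ∧ g K i ≤ γ)
    (hgA : ∀ K, g K ∈ W) (hgB : ∀ K, (fun i => g (K + 1) (i + 1)) ∈ W)
    (hθ' : max ω θc < θ') (hθ₅' : θ₅ ≤ θ') (hθ₃' : θ₃ ≤ θ')
    (hfmtA : ∀ K t τ, A K t τ = ∫ v, (∏ X ∈ fac K t τ,
      Real.exp (EA (g K) (uA K v) X - EA (g K) oneA X)) * oA K t τ v ∂(μ K t τ))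
    (hfmtB : ∀ K t τ, B K t τ = ∫ v, (∏ X ∈ fac K t τ,
      Real.exp (EB (fun i => g (K + 1) (i + 1)) (uB K v) X - EB (fun i => g (K + 1) (i + 1)) oneB X)) *
        oB K t τ v ∂(μ K t τ))
    (hint : ∀ K t, |t| ≤ l₀ → ∀ τ ∈ T K \ Bad K t,
      Integrable (fun v => (∏ X ∈ fac K t τ, Real.exp (EA (g K) (uA K v) X - EA (g K) oneA X)) *
        oA K t τ v) (μ K t τ) ∧
      Integrable (fun v => (∏ X ∈ fac K t τ,
        Real.exp (EB (fun i => g (K + 1) (i + 1)) (uB K v) X - EB (fun i => g (K + 1) (i + 1)) oneB X)) *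
        oB K t τ v) (μ K t τ))
    (hsc : ∀ K t, |t| ≤ l₀ → ∀ τ ∈ T K \ Bad K t, ∀ X ∈ fac K t τ, C.scale X ≤ K)
    (hposO : ∀ K t, |t| ≤ l₀ → ∀ τ ∈ T K \ Bad K t, ∀ v ∈ R.dom, 0 < oA K t τ v ∧ 0 < oB K t τ v)
    (hoff : ∀ K t, |t| ≤ l₀ → ∀ τ ∈ T K \ Bad K t, ∀ v, v ∉ R.dom →
      (∏ X ∈ fac K t τ, Real.exp (EA (g K) (uA K v) X - EA (g K) oneA X)) * oA K t τ v = 0 ∧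
      (∏ X ∈ fac K t τ,
        Real.exp (EB (fun i => g (K + 1) (i + 1)) (uB K v) X - EB (fun i => g (K + 1) (i + 1)) oneB X)) *
        oB K t τ v = 0)
    (hS : ∀ K t, |t| ≤ l₀ → ∀ τ ∈ T K \ Bad K t, ∀ v ∈ R.dom, ∀ j ≤ K,
      |(∑ X ∈ fac K t τ with C.scale X = j,
          (Real.log (Real.exp (EB (fun i => g (K + 1) (i + 1)) (uB K v) X
              - EB (fun i => g (K + 1) (i + 1)) oneB X))
            - Real.log (Real.exp (EA (g K) (uA K v) X - EA (g K) oneA X)))) - κ₁ K t τ j| ≤ S K t τ j)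
    (hM : ∀ K t, |t| ≤ l₀ → ∀ τ ∈ T K \ Bad K t,
      Multiplicity (fac K t τ) C.scale (fun X => Real.exp (-(κ * C.d X))) Cw vol Λ K)
    (hwit : ∀ K, ∃ v₁ ∈ R.dom, uA K v₁ = oneA ∧ uB K v₁ = oneB)
    (hO : ∀ K t, |t| ≤ l₀ → ∀ τ ∈ T K \ Bad K t, ∀ v ∈ R.dom,
      |Real.log (oB K t τ v) - Real.log (oA K t τ v) - cO K t τ| ≤ RO K t τ)
    (hvol : 0 < vol) (hl₀ : 0 ≤ l₀) (hE : 0 ≤ E) (ha0 : 0 < a) (ha1 : a < 1) (hθ'1 : θ' < 1) (hθ'Λ : θ' ≤ Λ)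
    (hSle : ∀ K t, |t| ≤ l₀ → ∀ τ ∈ T K \ Bad K t, ∀ j ≤ K, S K t τ j ≤ vol * (E * a ^ (K - j)))
    (hRO : ∀ K t, |t| ≤ l₀ → ∀ τ ∈ T K \ Bad K t, RO K t τ ≤ vol * rO K) (hrO : Summable rO)
    (hW : T4WeightBudget.RelWeightBound l₀ T A B Bad Wb)
    (hA : ∀ K t, |t| ≤ l₀ → ∀ τ ∈ T K, 0 ≤ A K t τ) (hB : ∀ K t, |t| ≤ l₀ → ∀ τ ∈ T K, 0 ≤ B K t τ)
    (hZA : ∀ K t, |t| ≤ l₀ → Z K t = ∑ τ ∈ T K, A K t τ)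
    (hZB : ∀ K t, |t| ≤ l₀ → Z (K + 1) t = ∑ τ ∈ T K, B K t τ)
    (hpos : ∀ K t, |t| ≤ l₀ → 0 < ∑ τ ∈ T K, A K t τ) :
    ∃ Cr : ℝ, 0 ≤ Cr ∧ ∀ c₀ s : ℕ → ℝ, Summable s →
      (∀ K t, |t| ≤ l₀ → ∀ τ ∈ T K \ Bad K t, |cO K t τ - c₀ K| ≤ vol * s K) →
      MatchingModConstants vol l₀
          (hybridDelta vol (fun K => (max Cw 1 * ((E + Cr) *
            ∑ x ∈ antidiagonal K, min (a ^ x.2) (θ' ^ x.1 * Λ ^ x.2)) + rO K) + (max Cw 1 * ((E + Cr) *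
            ∑ x ∈ antidiagonal K, min (a ^ x.2) (θ' ^ x.1 * Λ ^ x.2)) + s K)) Wb) Z ∧
        Summable (hybridDelta vol (fun K => (max Cw 1 * ((E + Cr) *
            ∑ x ∈ antidiagonal K, min (a ^ x.2) (θ' ^ x.1 * Λ ^ x.2)) + rO K) + (max Cw 1 * ((E + Cr) *
            ∑ x ∈ antidiagonal K, min (a ^ x.2) (θ' ^ x.1 * Λ ^ x.2)) + s K)) Wb) ∧
        (∀ t : ℝ, |t| ≤ l₀ → CauchySeq fun K => genFun Z K t) ∧
        TendstoUniformlyOn (fun K t => genFun Z K t) (genFunLim Z) atTop {t | |t| ≤ l₀} := by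
  obtain ⟨Cr, hCr, h⟩ := goodClause_summable_of_nodes_witness h9 hΛm hω hUL hG hP h5 hθ₅ hC₅ hloc hC₃ hθ₃ hθ₃1
    hgd hinj hCd hθc hbox hgA hgB hθ' hθ₅' hθ₃' hfmtA hfmtB hint hsc hposO hoff hS hM hwit hO hvol.le hE ha0 ha1
    hθ'1 hθ'Λ hSle hRO hrO
  refine ⟨Cr, hCr, fun c₀ s hs hO' => ?_⟩
  obtain ⟨hgood, hsum⟩ := h c₀ s hs hO'
  exact cauchy_of_goodClause hvol hl₀ hW hZA hZB hA hB hpos hsum hgood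

end Spine

/-! ## §5 All strings of a scheme: the node-U0 targets OUTRIGHT (the capstone re-keyed on (F′) + (O′)) -/

section Scheme

open Missing T4Continuum T4Assembly
open T4EtaRateMin (Readings LocalRate)
open T4RateLiaison (GaugeDominated)

variable {G : Type*} [GaugeGroup G] [MeasurableSpace G] [HaarData G] {O : Type*}

variable {C : Carriers} {ι X : Type} [MeasurableSpace ι] {R : Readings ι X} {W : Set (ℕ → ℝ)}
  {EA : Functional C C.BgA} {EB : Functional C C.BgB} {κ θ₅ C₅ C₉ ω θc Cd γ C₃ θ₃ P θ' : ℝ} {q : ℕ}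
  {Λm : ℕ → ℕ → ℝ} {CU : (ℕ → ℝ) → ℕ → ℝ} {g : ℕ → ℕ → ℝ} {uA : ℕ → ι → C.BgA} {uB : ℕ → ι → C.BgB}
  {oneA : C.BgA} {oneB : C.BgB} {Cw E a Λ : ℝ}

/-- **PER STRING**: the binders of `hybridNE7_of_nodes_witness` for the two runs' term families of ONE string `os` of a
scheme `Sc`, read off through the E1/E2 DICTIONARY `schemeZ Sc os (K₀+K) t = Σ_τ A K t τ`,
`schemeZ Sc os (K₀+K+1) t = Σ_τ B K t τ` on `|t| ≤ l₀` (binders), and the other kinds' centring (O′) for that string,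
give `T4MatchingAssembly.StringHybridNE7 Sc os l₀ vol K₀` OUTRIGHT (`T4MatchingClosure.stringHybridNE7_intro`).
[folklore] -/
theorem stringHybridNE7_of_nodes_witness {σ : Type} [DecidableEq σ] {l₀ vol : ℝ} {T : ℕ → Finset σ}
    {Bad : ℕ → ℝ → Finset σ} {A B : ℕ → ℝ → σ → ℝ} {μ : ℕ → ℝ → σ → Measure ι} {fac : ℕ → ℝ → σ → Finset C.Dom}
    {oA oB : ℕ → ℝ → σ → ι → ℝ} {κ₁ S : ℕ → ℝ → σ → ℕ → ℝ} {cO RO : ℕ → ℝ → σ → ℝ} {rO Wb c₀ s : ℕ → ℝ}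
    (Sc : TorusScheme G O) (os : List O) (K₀ : ℕ)
    (h9 : NE9 EA W κ Λm) (hΛm : FadingMemory C₉ ω Λm) (hω : 0 ≤ ω)
    (hUL : LipBackground EA W κ CU) (hG : PolyLipGrowth CU g P q) (hP : 0 ≤ P)
    (h5 : NE5 EA EB W κ θ₅ C₅) (hθ₅ : 0 ≤ θ₅) (hC₅ : 0 ≤ C₅)
    (hloc : LocalRate R C₃ θ₃) (hC₃ : 0 ≤ C₃) (hθ₃ : 0 ≤ θ₃) (hθ₃1 : θ₃ < 1) (hgd : GaugeDominated R uA uB)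
    (hinj : InjectedRate Cd 0 θc (fun K j => T4CouplingMatching.disc (g K) (g (K + 1)) j)) (hCd : 0 ≤ Cd)
    (hθc : 0 ≤ θc) (hbox : ∀ K i, i ≤ K → 0 < g K i ∧ g K i ≤ γ)
    (hgA : ∀ K, g K ∈ W) (hgB : ∀ K, (fun i => g (K + 1) (i + 1)) ∈ W)
    (hθ' : max ω θc < θ') (hθ₅' : θ₅ ≤ θ') (hθ₃' : θ₃ ≤ θ')
    (hfmtA : ∀ K t τ, A K t τ = ∫ v, (∏ X ∈ fac K t τ,
      Real.exp (EA (g K) (uA K v) X - EA (g K) oneA X)) * oA K t τ v ∂(μ K t τ))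
    (hfmtB : ∀ K t τ, B K t τ = ∫ v, (∏ X ∈ fac K t τ,
      Real.exp (EB (fun i => g (K + 1) (i + 1)) (uB K v) X - EB (fun i => g (K + 1) (i + 1)) oneB X)) *
        oB K t τ v ∂(μ K t τ))
    (hint : ∀ K t, |t| ≤ l₀ → ∀ τ ∈ T K \ Bad K t,
      Integrable (fun v => (∏ X ∈ fac K t τ, Real.exp (EA (g K) (uA K v) X - EA (g K) oneA X)) *
        oA K t τ v) (μ K t τ) ∧
      Integrable (fun v => (∏ X ∈ fac K t τ,
        Real.exp (EB (fun i => g (K + 1) (i + 1)) (uB K v) X - EB (fun i => g (K + 1) (i + 1)) oneB X)) *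
        oB K t τ v) (μ K t τ))
    (hsc : ∀ K t, |t| ≤ l₀ → ∀ τ ∈ T K \ Bad K t, ∀ X ∈ fac K t τ, C.scale X ≤ K)
    (hposO : ∀ K t, |t| ≤ l₀ → ∀ τ ∈ T K \ Bad K t, ∀ v ∈ R.dom, 0 < oA K t τ v ∧ 0 < oB K t τ v)
    (hoff : ∀ K t, |t| ≤ l₀ → ∀ τ ∈ T K \ Bad K t, ∀ v, v ∉ R.dom →
      (∏ X ∈ fac K t τ, Real.exp (EA (g K) (uA K v) X - EA (g K) oneA X)) * oA K t τ v = 0 ∧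
      (∏ X ∈ fac K t τ,
        Real.exp (EB (fun i => g (K + 1) (i + 1)) (uB K v) X - EB (fun i => g (K + 1) (i + 1)) oneB X)) *
        oB K t τ v = 0)
    (hS : ∀ K t, |t| ≤ l₀ → ∀ τ ∈ T K \ Bad K t, ∀ v ∈ R.dom, ∀ j ≤ K,
      |(∑ X ∈ fac K t τ with C.scale X = j,
          (Real.log (Real.exp (EB (fun i => g (K + 1) (i + 1)) (uB K v) X
              - EB (fun i => g (K + 1) (i + 1)) oneB X))
            - Real.log (Real.exp (EA (g K) (uA K v) X - EA (g K) oneA X)))) - κ₁ K t τ j| ≤ S K t τ j)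
    (hM : ∀ K t, |t| ≤ l₀ → ∀ τ ∈ T K \ Bad K t,
      Multiplicity (fac K t τ) C.scale (fun X => Real.exp (-(κ * C.d X))) Cw vol Λ K)
    (hwit : ∀ K, ∃ v₁ ∈ R.dom, uA K v₁ = oneA ∧ uB K v₁ = oneB)
    (hO : ∀ K t, |t| ≤ l₀ → ∀ τ ∈ T K \ Bad K t, ∀ v ∈ R.dom,
      |Real.log (oB K t τ v) - Real.log (oA K t τ v) - cO K t τ| ≤ RO K t τ)
    (hvol : 0 ≤ vol) (hE : 0 ≤ E) (ha0 : 0 < a) (ha1 : a < 1) (hθ'1 : θ' < 1) (hθ'Λ : θ' ≤ Λ)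
    (hSle : ∀ K t, |t| ≤ l₀ → ∀ τ ∈ T K \ Bad K t, ∀ j ≤ K, S K t τ j ≤ vol * (E * a ^ (K - j)))
    (hRO : ∀ K t, |t| ≤ l₀ → ∀ τ ∈ T K \ Bad K t, RO K t τ ≤ vol * rO K) (hrO : Summable rO)
    (hW : T4WeightBudget.RelWeightBound l₀ T A B Bad Wb)
    (hA : ∀ K t, |t| ≤ l₀ → ∀ τ ∈ T K, 0 ≤ A K t τ) (hB : ∀ K t, |t| ≤ l₀ → ∀ τ ∈ T K, 0 ≤ B K t τ)
    (hZA : ∀ K t, |t| ≤ l₀ → T4GenFunBounds.schemeZ Sc os (K₀ + K) t = ∑ τ ∈ T K, A K t τ)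
    (hZB : ∀ K t, |t| ≤ l₀ → T4GenFunBounds.schemeZ Sc os (K₀ + K + 1) t = ∑ τ ∈ T K, B K t τ)
    (hs : Summable s)
    (hO' : ∀ K t, |t| ≤ l₀ → ∀ τ ∈ T K \ Bad K t, |cO K t τ - c₀ K| ≤ vol * s K) :
    StringHybridNE7 Sc os l₀ vol K₀ := by
  obtain ⟨Cr, -, h⟩ := hybridNE7_of_nodes_witness h9 hΛm hω hUL hG hP h5 hθ₅ hC₅ hloc hC₃ hθ₃ hθ₃1 hgd hinj hCd
    hθc hbox hgA hgB hθ' hθ₅' hθ₃' hfmtA hfmtB hint hsc hposO hoff hS hM hwit hO hvol hE ha0 ha1 hθ'1 hθ'Λ hSle hRO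
    hrO hW hA hB
  exact T4MatchingClosure.stringHybridNE7_intro Sc os K₀ (h c₀ s hs hO') hZA hZB

/-- **ALL STRINGS, END TO END — THE TERM-WISE ROUTE'S CAPSTONE RE-KEYED (lineage t4-ne7-p1, gens 1–5).**  The tower
data are STRING-INDEPENDENT (the sibling nodes' typed outputs, NOT PRINTED as two-run statements); the term data are
indexed by the string `os` (index types `σ os`, families `T os`, `Bad os`, `A os`, `B os`, …, a volume factor `vol os > 0`
and a head length `K₀ os`), with the per-string binders (F) format, (S) sizes, (M) multiplicity, (O) other kinds' radii +
`Summable (rO os)`, (O′) the other kinds' CENTRES against `t,τ`-free class constants with summable deviations — the honest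
remainder of hazard H-U5b-1, NOT PRINTED —, (W) the weight half `RelWeightBound`, L1-pos, the E1/E2 dictionary to
`schemeZ Sc os (K₀ os + K)`, and the reference witness (F′) of the string-independent background maps.  CONCLUSION,
with NO rate constant in any premise: the node-U0 targets hold for the scheme — the continuum limit of every joint
expectation of the gauge-invariant observables EXISTS along the full sequence of spacings, limit points are UNIQUE, and
subsequential limits AGREE (`T4MatchingAssembly.hasContinuumLimit_of_hybridNE7`, `0 < l₀`, scheme regularity `0 ≤ β_K`,
measurable observables bounded by `1`).  HONEST FRAMING: pure YM₄ on a FIXED FINITE torus, rung (B)+1 of the cell's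
ladder, CONDITIONAL on every binder named here — in particular NE7 (both halves) is NOT PRINTED and the upstream
conditionals (BetaPertH behind node U2's asymptotic-freedom input, (B), (B^μ)) sit inside the producers of `hinj` / the
weight half exactly as those modules name them; nothing here is infinite volume, a mass gap, or the Clay problem.
[folklore] -/
theorem hasContinuumLimit_of_nodes_witness [RegularGaugeGroup G] {σ : List O → Type} [∀ os, DecidableEq (σ os)]
    {l₀ : ℝ} {vol : List O → ℝ} {K₀ : List O → ℕ} {T : (os : List O) → ℕ → Finset (σ os)}
    {Bad : (os : List O) → ℕ → ℝ → Finset (σ os)} {A B : (os : List O) → ℕ → ℝ → σ os → ℝ}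
    {μ : (os : List O) → ℕ → ℝ → σ os → Measure ι} {fac : (os : List O) → ℕ → ℝ → σ os → Finset C.Dom}
    {oA oB : (os : List O) → ℕ → ℝ → σ os → ι → ℝ} {κ₁ S : (os : List O) → ℕ → ℝ → σ os → ℕ → ℝ}
    {cO RO : (os : List O) → ℕ → ℝ → σ os → ℝ} {rO Wb : List O → ℕ → ℝ}
    (Sc : TorusScheme G O) (hβ : ∀ K, 0 ≤ Sc.β K) (hm : ∀ K o, Measurable (Sc.obs K o))
    (h1 : ∀ K o U, |Sc.obs K o U| ≤ 1) (hl₀ : 0 < l₀)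
    (h9 : NE9 EA W κ Λm) (hΛm : FadingMemory C₉ ω Λm) (hω : 0 ≤ ω)
    (hUL : LipBackground EA W κ CU) (hG : PolyLipGrowth CU g P q) (hP : 0 ≤ P)
    (h5 : NE5 EA EB W κ θ₅ C₅) (hθ₅ : 0 ≤ θ₅) (hC₅ : 0 ≤ C₅)
    (hloc : LocalRate R C₃ θ₃) (hC₃ : 0 ≤ C₃) (hθ₃ : 0 ≤ θ₃) (hθ₃1 : θ₃ < 1) (hgd : GaugeDominated R uA uB)
    (hinj : InjectedRate Cd 0 θc (fun K j => T4CouplingMatching.disc (g K) (g (K + 1)) j)) (hCd : 0 ≤ Cd)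
    (hθc : 0 ≤ θc) (hbox : ∀ K i, i ≤ K → 0 < g K i ∧ g K i ≤ γ)
    (hgA : ∀ K, g K ∈ W) (hgB : ∀ K, (fun i => g (K + 1) (i + 1)) ∈ W)
    (hθ' : max ω θc < θ') (hθ₅' : θ₅ ≤ θ') (hθ₃' : θ₃ ≤ θ')
    (hE : 0 ≤ E) (ha0 : 0 < a) (ha1 : a < 1) (hθ'1 : θ' < 1) (hθ'Λ : θ' ≤ Λ)
    (hwit : ∀ K, ∃ v₁ ∈ R.dom, uA K v₁ = oneA ∧ uB K v₁ = oneB)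
    (hvol : ∀ os, 0 < vol os)
    (hfmtA : ∀ os K t τ, A os K t τ = ∫ v, (∏ X ∈ fac os K t τ,
      Real.exp (EA (g K) (uA K v) X - EA (g K) oneA X)) * oA os K t τ v ∂(μ os K t τ))
    (hfmtB : ∀ os K t τ, B os K t τ = ∫ v, (∏ X ∈ fac os K t τ,
      Real.exp (EB (fun i => g (K + 1) (i + 1)) (uB K v) X - EB (fun i => g (K + 1) (i + 1)) oneB X)) *
        oB os K t τ v ∂(μ os K t τ))
    (hint : ∀ os K t, |t| ≤ l₀ → ∀ τ ∈ T os K \ Bad os K t,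
      Integrable (fun v => (∏ X ∈ fac os K t τ, Real.exp (EA (g K) (uA K v) X - EA (g K) oneA X)) *
        oA os K t τ v) (μ os K t τ) ∧
      Integrable (fun v => (∏ X ∈ fac os K t τ,
        Real.exp (EB (fun i => g (K + 1) (i + 1)) (uB K v) X - EB (fun i => g (K + 1) (i + 1)) oneB X)) *
        oB os K t τ v) (μ os K t τ))
    (hsc : ∀ os K t, |t| ≤ l₀ → ∀ τ ∈ T os K \ Bad os K t, ∀ X ∈ fac os K t τ, C.scale X ≤ K)
    (hposO : ∀ os K t, |t| ≤ l₀ → ∀ τ ∈ T os K \ Bad os K t, ∀ v ∈ R.dom, 0 < oA os K t τ v ∧ 0 < oB os K t τ v)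
    (hoff : ∀ os K t, |t| ≤ l₀ → ∀ τ ∈ T os K \ Bad os K t, ∀ v, v ∉ R.dom →
      (∏ X ∈ fac os K t τ, Real.exp (EA (g K) (uA K v) X - EA (g K) oneA X)) * oA os K t τ v = 0 ∧
      (∏ X ∈ fac os K t τ,
        Real.exp (EB (fun i => g (K + 1) (i + 1)) (uB K v) X - EB (fun i => g (K + 1) (i + 1)) oneB X)) *
        oB os K t τ v = 0)
    (hS : ∀ os K t, |t| ≤ l₀ → ∀ τ ∈ T os K \ Bad os K t, ∀ v ∈ R.dom, ∀ j ≤ K,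
      |(∑ X ∈ fac os K t τ with C.scale X = j,
          (Real.log (Real.exp (EB (fun i => g (K + 1) (i + 1)) (uB K v) X
              - EB (fun i => g (K + 1) (i + 1)) oneB X))
            - Real.log (Real.exp (EA (g K) (uA K v) X - EA (g K) oneA X)))) - κ₁ os K t τ j| ≤ S os K t τ j)
    (hM : ∀ os K t, |t| ≤ l₀ → ∀ τ ∈ T os K \ Bad os K t,
      Multiplicity (fac os K t τ) C.scale (fun X => Real.exp (-(κ * C.d X))) Cw (vol os) Λ K)
    (hO : ∀ os K t, |t| ≤ l₀ → ∀ τ ∈ T os K \ Bad os K t, ∀ v ∈ R.dom,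
      |Real.log (oB os K t τ v) - Real.log (oA os K t τ v) - cO os K t τ| ≤ RO os K t τ)
    (hSle : ∀ os K t, |t| ≤ l₀ → ∀ τ ∈ T os K \ Bad os K t, ∀ j ≤ K,
      S os K t τ j ≤ vol os * (E * a ^ (K - j)))
    (hRO : ∀ os K t, |t| ≤ l₀ → ∀ τ ∈ T os K \ Bad os K t, RO os K t τ ≤ vol os * rO os K)
    (hrO : ∀ os, Summable (rO os))
    (hdevO : ∀ os, ∃ c₀ s : ℕ → ℝ, Summable s ∧
      ∀ K t, |t| ≤ l₀ → ∀ τ ∈ T os K \ Bad os K t, |cO os K t τ - c₀ K| ≤ vol os * s K)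
    (hW : ∀ os, T4WeightBudget.RelWeightBound l₀ (T os) (A os) (B os) (Bad os) (Wb os))
    (hA : ∀ os K t, |t| ≤ l₀ → ∀ τ ∈ T os K, 0 ≤ A os K t τ)
    (hB : ∀ os K t, |t| ≤ l₀ → ∀ τ ∈ T os K, 0 ≤ B os K t τ)
    (hZA : ∀ os K t, |t| ≤ l₀ → T4GenFunBounds.schemeZ Sc os (K₀ os + K) t = ∑ τ ∈ T os K, A os K t τ)
    (hZB : ∀ os K t, |t| ≤ l₀ → T4GenFunBounds.schemeZ Sc os (K₀ os + K + 1) t = ∑ τ ∈ T os K, B os K t τ) :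
    HasContinuumLimit Sc ∧ HasUniqueLimitPoints Sc ∧ LimitPointsAgree Sc := by
  refine hasContinuumLimit_of_hybridNE7 Sc hβ hm h1 hl₀ fun os => ?_
  obtain ⟨c₀, s, hs, hO'⟩ := hdevO os
  exact ⟨vol os, K₀ os, hvol os,
    stringHybridNE7_of_nodes_witness Sc os (K₀ os) h9 hΛm hω hUL hG hP h5 hθ₅ hC₅ hloc hC₃ hθ₃ hθ₃1 hgd hinj hCd
      hθc hbox hgA hgB hθ' hθ₅' hθ₃' (hfmtA os) (hfmtB os) (hint os) (hsc os) (hposO os) (hoff os) (hS os) (hM os)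
      hwit (hO os) (hvol os).le hE ha0 ha1 hθ'1 hθ'Λ (hSle os) (hRO os) (hrO os) (hW os) (hA os) (hB os) (hZA os)
      (hZB os) hs hO'⟩

end Scheme

end Literature.MathematicalPhysics.QuantumFieldTheory.Balaban1983to89.T4TermwiseDeviation
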